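import Summits.Schanuel.Schanuel.Theorems.DiophantineDichotomyKhovanskiiApproxTypeEvDefs
import Summits.Schanuel.Schanuel.Theorems.DiophantineDichotomyKhovanskiiApproxTypeEvLambertLiouvilleWindow
import Summits.Schanuel.Schanuel.Theorems.DiophantineDichotomyKhovanskiiApproxTypeEvLambertExpOneDegreeMeasure
import Summits.Schanuel.Schanuel.Theorems.DiophantineDichotomyKhovanskiiApproxTypeEvLambertAnchoredPoint
import Summits.Schanuel.Schanuel.Theorems.DiophantineDichotomyKhovanskiiApproxTypeEvLambertSyncApproximant
import Summits.Schanuel.Schanuel.Theorems.DiophantineDichotomyKhovanskiiApproxTypeEvLambertAnchoredLevel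
import Summits.Schanuel.Schanuel.Theorems.DiophantineDichotomyKhovanskiiApproxTypeEvLambertAnchoredDist
import Summits.Schanuel.Schanuel.Theorems.DiophantineDichotomyKhovanskiiApproxTypeEvLambertAnchoredEndgame
import HarnessLib

/-!
# Route `DiophantineDichotomy`, crux `KhovanskiiApproxTypeEv` (stmt-Schanuel-14972), line `lambert-liouville-kill`:
# the rank-3 (ANCHORED) HARDNESS CERTIFICATE `notLiouville_lambert_of_evAnchored` — already the anchored
# restatement of the crux implies that no Lambert number `W(1/k)` is Liouville

Crux `Summit.Schanuel.Schanuel.Theses.DiophantineDichotomy.KhovanskiiApproxTypeEv` (item stmt-Schanuel-14972).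
Second composition file of the certificate line `lambert-liouville-kill` (skeleton
`Cruxes/KhovanskiiApproxTypeEv/Lines/lambert_liouville_kill.lean`, lead `prover-line-stmt-Schanuel-14972-a1-0`);
the rank-2 certificate `notLiouville_lambert_of_ev` is `Theorems/DiophantineDichotomyKhovanskiiApproxTypeEvLambertLiouville.lean`.
This file closes, SORRY-FREE and with NO named-fact hypothesis, the registered sub-goal

  `notLiouville_lambert_of_evAnchored : KhovanskiiApproxTypeEvAnchored → ∀ k x, 1 ≤ k → 0 < x → k·x·eˣ = 1 → ¬ Liouville x`

(`KhovanskiiApproxTypeEvAnchored` = the crux on the anchored family `s = (1, iπ, s₂, …)`, the planners'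
restatement R1 of `Lines/Sketch-dead.md` and what the route consumes, `schanuel_of_anchored` p124086) from the
landed stubs `stub_liouvilleWindow` (p127801), `stub_expOneDegreeMeasure` (p127822), `stub_anchoredPoint`
(p127915), `stub_syncApproximant` (p127962), `stub_anchoredLevel`, `stub_anchoredDist`, `stub_anchoredEndgame`
(all `--supports stmt-Schanuel-14972`), and gives the second, independent proof `notLiouville_lambert_of_ev'` of
the rank-2 certificate through the anchored family.  So restating the crux to the anchored family does NOT shed
its Lambert–Liouville content Z′ = "no `W(1/k)` is Liouville".

## The argument (card §(3), threshold `a < 1/2` at `n + 2 = 3`)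
At the anchored free Khovanskii point `s = (1, iπ, x)`, `k x eˣ = 1` (stub 7: system `z₀ − 1`, `y₁ + 1`,
`k z₂ y₂ − 1`, Jacobian `diag(1, −1, k eˣ(1 + x))`; `(1, iπ, x)` is `ℚ`-free for irrational `x`), Philippon's
approximation property in transcendence degree `≤ 2` at the PAIR `(iπ, e)` (PROVED in tree,
`approximationProperty_trdeg_le_two`), synchronised with a Liouville scale `q` of `x` by the per-degree
measure of algebraic approximation of `e` (stub 8: `γ₂ ≈ (iπ, e)` of degree `≤ (cΔ)²`, height
`H₂ ∈ [q, q^{M₀}]`, quality `H₂^{−Δ/c}`), yields the challenger `(1, β, p/q, α, −1, q/(kp))` of level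
`(⌈(cΔ)²⌉, H₂)` (stub 9) at distance `≤ max(H₂^{−Δ/c}, (1 + 2/(kx²)) q^{−m})` (stub 10), which beats
`exp(−C(Dᵃ log H₂ + Dᵇ))` for every `a < 1/2` once `Δ` and `q` are large (stub 11) — contradicting the
anchored crux past its threshold.

## Contents
* `notLiouville_lambert_of_evAnchored` — the registered certificate (composition, verbatim the skeleton's);
* `notLiouville_lambert_of_ev'` — the crux as filed through the anchored family (forgetting the anchors).
-/

noncomputable section

-- `Summit.Schanuel.Schanuel.…` is the mandated summit/sub-problem namespace (single-conjunct summit), hence: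
set_option linter.dupNamespace false

open scoped BigOperators

namespace Summit.Schanuel.Schanuel.Cruxes.KhovanskiiApproxTypeEv.LambertLiouvilleKill

open Summit.Schanuel.Schanuel.Theses.DiophantineDichotomy (KhovanskiiApproxTypeEv)
open Summit.Schanuel.Schanuel.Cruxes.KhovanskiiApproxType.LwSmallHeight (IsFreeKhovanskii)
open Summit.Schanuel.Schanuel.Cruxes.KhovanskiiApproxTypeEv.AnchoredReduction
  (ApproxTypeEvAt khovanskiiApproxTypeEv_iff KhovanskiiApproxTypeEvAnchored)
open Polynomial Complex

/-- **`KhovanskiiApproxTypeEvAnchored` ⟹ no Lambert number `W(1/k)` is Liouville** (registered hardness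
certificate of crux stmt-Schanuel-14972 for its ANCHORED restatement; sorry-free from the landed stubs 1, 2,
7–11 of line `lambert-liouville-kill`).  The anchored crux is what the route consumes
(`schanuel_of_anchored`, p124086); this is its extra-Schanuel Diophantine content at the anchored free
Khovanskii points `(1, iπ, W(1/k))`: Philippon's AP in transcendence degree `≤ 2` at `(iπ, e)` (PROVED),
synchronised with the Liouville scales of `x` by the per-degree approximation measure of `e`, produces
challengers `(1, β, p/q, α, −1, q/(kp))` beating every exponent `a < 1/2`. [folklore] -/
theorem notLiouville_lambert_of_evAnchored :
    KhovanskiiApproxTypeEvAnchored → ∀ (k : ℕ) (x : ℝ), 1 ≤ k → 0 < x →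
      (k : ℝ) * x * Real.exp x = 1 → ¬ Liouville x := by
  intro hEvA k x hk hx0 hx hL
  -- the anchored point and the anchored crux at n + 2 = 3
  obtain ⟨hfree, hli⟩ := stub_anchoredPoint k x hk hx0 hx hL.irrational
  obtain ⟨a, b, C, ha, hC, hall⟩ :=
    hEvA 1 ![(1 : ℂ), Complex.I * Real.pi, (x : ℂ)] (by simp) (by simp) hli hfree
  have ha2 : a < 1 / 2 := by
    have h1 : (1 : ℝ) / (((1 + 2 : ℕ) : ℝ) - 1) = 1 / 2 := by norm_num
    rw [h1] at ha
    exact ha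
  -- k x < 1
  have hkpos : (0 : ℝ) < k := by exact_mod_cast (show 0 < k by omega)
  have hkx : (k : ℝ) * x < 1 := by
    have hexp : 1 < Real.exp x := Real.one_lt_exp_iff.mpr hx0
    have hkx0 : 0 < (k : ℝ) * x := mul_pos hkpos hx0
    calc (k : ℝ) * x = (k : ℝ) * x * 1 := by ring
      _ < (k : ℝ) * x * Real.exp x := by gcongr
      _ = 1 := hx
  set K : ℝ := 1 + 2 / ((k : ℝ) * x ^ 2) with hK
  have hK0 : 0 ≤ K := by positivity
  -- the synchronised approximation property at (iπ, e) and the endgame data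
  obtain ⟨c, hc1, hsync⟩ := stub_syncApproximant stub_expOneDegreeMeasure
  obtain ⟨Δ, hcΔ, hend⟩ := stub_anchoredEndgame a b C c K ha2 hC hc1 hK0
  obtain ⟨M₀, hM₀, q₁, hq₁⟩ := hsync Δ hcΔ
  obtain ⟨m, q₀, hfin⟩ := hend M₀ hM₀
  -- the budget D = ⌈(cΔ)²⌉ and the threshold of the eventual crux at D
  set D : ℕ := ⌈(c * Δ) ^ 2⌉₊ with hD
  have hcΔpos : 0 < (c * Δ) ^ 2 := by
    have : 0 < c * Δ := mul_pos (by linarith) (by linarith)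
    positivity
  have hD1 : 1 ≤ D := Nat.one_le_iff_ne_zero.mpr (Nat.ceil_pos.mpr hcΔpos).ne'
  have hDle : (D : ℝ) ≤ (c * Δ) ^ 2 + 1 := (Nat.ceil_lt_add_one hcΔpos.le).le
  obtain ⟨H₀, hH₀⟩ := hall D
  -- the Liouville scale
  set N : ℕ := max (max H₀ q₁) ⌈q₀⌉₊ with hN
  obtain ⟨p, q, hNq, hp, hkpq, hwin, hclose⟩ := stub_liouvilleWindow x k hL hx0 hkx m N
  have hq1 : 1 ≤ q := le_trans (le_trans hp (Nat.le_mul_of_pos_left p (by omega))) hkpq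
  have hq₁q : q₁ ≤ q := le_trans (le_trans (le_max_right _ _) (le_max_left _ _)) hNq
  have hq₀q : q₀ ≤ (q : ℝ) := by
    have h1 : ⌈q₀⌉₊ ≤ q := le_trans (le_max_right _ _) hNq
    exact (Nat.le_ceil q₀).trans (by exact_mod_cast h1)
  -- the synchronised approximant of (iπ, e) at the scale q
  obtain ⟨γ₂, d₂, H₂, hfr₂, hcert₂, hd₂, hqH, hHq, hqual⟩ := hq₁ q hq₁q
  have hd₂D : d₂ ≤ D := by
    have h1 : (d₂ : ℝ) ≤ ((⌈(c * Δ) ^ 2⌉₊ : ℕ) : ℝ) := hd₂.trans (Nat.le_ceil _)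
    exact_mod_cast h1
  have hH₀H : H₀ ≤ H₂ :=
    le_trans (le_trans (le_trans (le_max_left _ _) (le_max_left _ _)) hNq) hqH
  -- admissibility of the combined challenger at level (D, H₂)
  obtain ⟨hfr, hcl⟩ :=
    stub_anchoredLevel D k p q γ₂ d₂ H₂ hk hp hkpq hqH hd₂D hD1 hfr₂ hcert₂
  have key : Real.exp (-(C * ((D : ℝ) ^ a * Real.log H₂ + (D : ℝ) ^ b))) ≤
      ‖Sum.elim ![(1 : ℂ), γ₂ 0, (p : ℂ) / q] ![γ₂ 1, -1, (q : ℂ) / (k * p)] -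
          Sum.elim ![(1 : ℂ), Complex.I * Real.pi, (x : ℂ)]
            (Complex.exp ∘ ![(1 : ℂ), Complex.I * Real.pi, (x : ℂ)])‖ :=
    hH₀ H₂ (Sum.elim ![(1 : ℂ), γ₂ 0, (p : ℂ) / q] ![γ₂ 1, -1, (q : ℂ) / (k * p)]) hH₀H hfr hcl
  -- its distance
  have hdist := stub_anchoredDist k p q x γ₂ hk hx0 hx hp hq1 hwin
  have h2 : K * |x - (p : ℝ) / q| ≤ K * (1 / (q : ℝ) ^ m) :=
    mul_le_mul_of_nonneg_left hclose hK0
  have h3 := max_le_max hqual h2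
  have hqH' : (q : ℝ) ≤ H₂ := by exact_mod_cast hqH
  have h4 := hfin (q : ℝ) (H₂ : ℝ) D hq₀q hqH' hHq hD1 hDle
  linarith [key, hdist, h3, h4]

/-- **The crux AS FILED, through the anchored family** (the crux gives the anchored crux by forgetting
the anchors — `evAnchored_of_ev`, p124086, re-proved inline): a second, independent proof of the rank-2
certificate `notLiouville_lambert_of_ev`, through rank 3. [folklore] -/
theorem notLiouville_lambert_of_ev' (hEv : KhovanskiiApproxTypeEv)
    (k : ℕ) (x : ℝ) (hk : 1 ≤ k) (hx0 : 0 < x) (hx : (k : ℝ) * x * Real.exp x = 1) :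
    ¬ Liouville x := by
  refine notLiouville_lambert_of_evAnchored ?_ k x hk hx0 hx
  intro n s _h0 _h1 hs hfree
  exact khovanskiiApproxTypeEv_iff.1 hEv (n + 2) s (by omega) hs hfree

end Summit.Schanuel.Schanuel.Cruxes.KhovanskiiApproxTypeEv.LambertLiouvilleKill

end
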